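import Literature.MathematicalPhysics.QuantumFieldTheory.QCDTransferMatrix
import HarnessLib

/-!
# The number of quark modes of one time slice is `12 N_f S³`
(stub `stub_card_sliceFermiIdx` of line `twisted_trace_transfer` for crux
`QuarksAsStableAction.StableActionBridge`, item stmt-QuantumFields-9737, `--supports`; sub-goal W6c)

One time slice of lattice QCD on the spatial three-torus of side `S` carries the quark modes
`SliceQuarkVar Nf S = Fin Nf × (TorusSite 3 S × Fin 3 × Fin 4)` (flavour × spatial site × colour ×
Dirac index), linearly enumerated by `SliceFermiIdx Nf S = Fin (card (SliceQuarkVar Nf S))`.  Its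
cardinality is `N_f · S³ · 3 · 4 = 12 N_f S³`; in particular half filling `6 N_f S³` is even (used in
the vacuum-parity clause of the line).  Pure counting: `Fintype.card_fin`, `Fintype.card_prod`,
`Fintype.card_fun`, `ZMod.card`.  [folklore]
-/

open Literature.MathematicalPhysics.QuantumFieldTheory
open Literature.Probability.LatticeModels (TorusSite)

namespace Summit.QuantumFields.QCD.Cruxes.StableActionBridge.TwistedTraceTransfer

/-- **Sub-goal W6c: the number of quark modes of one time slice is `12 N_f S³`** (flavour × site ×
colour × Dirac), in particular a multiple of `4` — so half filling `6 N_f S³` is even. [folklore] -/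
theorem stub_card_sliceFermiIdx : ∀ (Nf S : ℕ) [NeZero S], Fintype.card (SliceFermiIdx Nf S) = 12 * Nf * S ^ 3 := by
  intro Nf S _
  rw [Fintype.card_fin]
  simp only [SliceQuarkVar, TorusSite, Fintype.card_prod, Fintype.card_fun, Fintype.card_fin,
    ZMod.card]
  ring

end Summit.QuantumFields.QCD.Cruxes.StableActionBridge.TwistedTraceTransfer
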